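import Summits.HubbardSuperconductivity.HubbardLadder.PairCorrListRows
import Summits.HubbardSuperconductivity.HubbardLadder.PairCorrSectorHalfRows
import HarnessLib

/-!
# Rung R3 tooling — LIST WINDOWS at `L = 4` from the ± PAIRS of the first announced `pair_dd` job,
# and the `u`-transport of a window-free (`κ = 0`) sector certificate

HONEST FRAMING (page 1): ladder R1–R4 with certified numbers; no claim on H/H₀. This file proves SOUNDNESS
EDGES only; no certificate of the kind it consumes exists (no `pair_dd` instance has been run by anyone; result
line (iii) of record: no R3 instance has been run; no dichotomy is certified at any size; there are no brackets to
overlap). Nothing here is a statement about `HubbardDisplaysSuperconductivity` / `H₀`. The instance below is at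
HALF FILLING, `U = 4` — it is NOT an R3 instance (R3 = `U = 8`, `δ = 1/8`); whether such a row belongs in the packet
is the lead's / the R2 seat's decision.

WHY. The engines announced (run/shared/lean/engines/REQUESTS.jsonl L893, eng-sdp-1, 2026-08-20T16:04Z) that their
first `pair_dd` certificate job (reader-validation instances for the admission of the objective kind; prepared,
sequenced after the running H6c leg, NOT submitted) carries, on the `4 × 4`, `t = 1`, `t' = 0`, `U = 4` torus in
the sector `(16, S^z = 0)` and for the class mean `λ = 1/4` over `S((1,1)) = {(1,1),(1,3),(3,1),(3,3)}`:
PD1w / PD1wm — `a = 0`, coefficients `+1/4` / `−1/4`, exactly ONE `energy_upper u = −7488692256025/2³⁹` (the constant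
of the in-tree E2 node `Bounds.torusUpper_mbbootE2_4x4_U4_N16`, verbatim); PD1 / PD1m — `objective_h0_coeff a = 1`,
coefficients `±1/4`, NO `energy_upper` (`κ = 0`). `PairCorrSectorHalfRows` (#120 part 1) reads each file ALONE
(one-sided rows). This file reads the ± PAIRS as the cell's LIST WINDOW object `PairListWindowCert` (#117):

* §2b `TorusSectorObsCertTT'.transportU` — a certificate with `κ = 0` does not involve `u`, so the same data give
  the certificate at every `u'`: a window-free file is moved to the `u` of a typed node before it is consumed.
* §3b `pairListWindowCert_4x4_U4_N16_tp0_of_mbbootE2` (PD1w / PD1wm: window `[q₊/16, −q₋/16]` on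
  `Σᵢ λᵢ P̄_d(4, rᵢ; ψ)`, E2 claim as the one explicit hypothesis; `m = 3`, `N ≡ 16` instance of
  `PairListWindowCert.ofSectorListCerts`), `pairListWindowCert_4x4_U4_N16_tp0_h0coeff_nonneg_of_certs` (PD1 / PD1m,
  any `a ≥ 0`, files at `u` with an upper claim `≤ u`, any typed upper node `u'`: window
  `[(q₊ − a u')/16, (a u' − q₋)/16]`) and its E2-keyed form `…_of_mbbootE2`; each with its `_lo_hi` lemma;
* typed obligation `PairDDListWindowsFourE2` (house style `@[conjecture] def` + `_holds`, PROVED — an implication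
  from certificates nobody holds).

No number is introduced: every constant is a hypothesis or the constant of a typed node already in the tree.
References: WangEtAl2024 §3 (observable SDP bounds under an energy window), Han2020Bootstrap §2–§3 (energy in the
objective), QinEtAl2020 §II eqs. (2)–(4) (the d-wave pair–pair correlator), Tasaki2020 §2.1. Cell documents:
`pub-hubbard-r3/R3-PAIRROWS-SPEC.md` §5′–§5⁗.
-/

noncomputable section

namespace Summit.HubbardSuperconductivity.HubbardLadder

open Matrix Finset Literature.MathematicalPhysics.QuantumLattice Literature.Probability.LatticeModels
open scoped ComplexOrder

/-! ## 2b. `u`-transport of a window-free certificate (`κ = 0`) -/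

section TransportU

variable {L : ℕ} [NeZero L] {t t' U : ℝ} {N : ℕ} {M u q : ℝ}
  {X : Matrix (Finset (Orb (FermionTorus 2 L))) (Finset (Orb (FermionTorus 2 L))) ℂ}

/-- **`u`-transport for a certificate with vanishing energy multiplier (`κ = 0`).** The certificate identity of
`TorusSectorObsCertTT'` involves `u` only through the term `κ • (u • 1 − H)`; when the producer's file carries no
`energy_upper` (the announced `objective_h0_coeff` cases PD1 / PD1m have `κ = 0`), the SAME data certify `X ≥ q` on
the sector at every `u'` — so such a file is moved to the `u` of any typed energy node before it is consumed.
HONEST FRAMING: ladder R1–R4 with certified numbers; no claim on H/H₀. [folklore] -/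
def TorusSectorObsCertTT'.transportU (C : TorusSectorObsCertTT' L t t' U N M u X q) (hκ0 : C.κ = 0)
    (u' : ℝ) : TorusSectorObsCertTT' L t t' U N M u' X q :=
  { C with
    hcert := by
      have h := C.hcert
      simp only [hκ0, Complex.ofReal_zero, zero_smul, sub_zero] at h ⊢
      exact h }

/-- The transported certificate keeps `κ = 0`. [folklore] -/
@[simp] theorem TorusSectorObsCertTT'.transportU_κ (C : TorusSectorObsCertTT' L t t' U N M u X q)
    (hκ0 : C.κ = 0) (u' : ℝ) : (C.transportU hκ0 u').κ = C.κ := rfl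

end TransportU

section FourByFourWindows

/-! ### 3b. The ± pairs of the first announced `pair_dd` job as LIST WINDOWS (engines REQUESTS L893:
PD1w / PD1wm = a = 0, `±1/4` class mean over `S((1,1))`, ONE `energy_upper` = the E2 node verbatim;
PD1 / PD1m = `objective_h0_coeff` a = 1, `±1/4`, no `energy_upper`, κ = 0) -/

/-- **PD1w / PD1wm reading (a = 0; the `+λ` and the `−λ` file, both written against the E2 node
`u = −7488692256025/2³⁹` verbatim).** Together with the E2 claim they give the LIST WINDOW `[q₊/16, −q₋/16]` on
`Σᵢ λᵢ P̄_d(4, rᵢ; ψ)` over every unit ground state `ψ` of the sector `(16, S^z = 0)` of the `4 × 4`, `t' = 0`,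
`U = 4` torus — the instance `m = 3`, `N ≡ 16` of `PairListWindowCert.ofSectorListCerts` (#117). NOT RUN (the job is
prepared and sequenced by the engines, not submitted; a float leg is orientation only — rows book on
verifier-B-passed rational files). HONEST FRAMING: ladder R1–R4 with certified numbers; no claim on H/H₀.
[cite: QinEtAl2020, §II eqs. (2)–(4)] -/
def pairListWindowCert_4x4_U4_N16_tp0_of_mbbootE2 {n : ℕ} (lam : Fin n → ℝ) (r : Fin n → Site 2)
    {qp qm : ℝ}
    (Cp : TorusSectorObsCertTT' 4 1 0 4 16 0 ((-7488692256025 : ℝ) / 2 ^ 39) (pairListObjective 4 lam r) qp)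
    (Cm : TorusSectorObsCertTT' 4 1 0 4 16 0 ((-7488692256025 : ℝ) / 2 ^ 39)
      (pairListObjective 4 (fun i => -lam i) r) qm)
    (hE2 : Bounds.torusUpper_mbbootE2_4x4_U4_N16) :
    PairListWindowCert (fun L => hubbardTorusTT' L 1 0 4) (fun _ => 16) 4 lam r :=
  PairListWindowCert.ofSectorListCerts 3 1 0 4 (fun _ => 16) lam r Cp Cm
    (minEnergyOn_szSector_4x4_U4_N16_tp0_le (Bounds.groundEnergyAt_4x4_U4_N16_le_of_claim hE2))
    (minEnergyOn_szSector_4x4_U4_N16_tp0_le (Bounds.groundEnergyAt_4x4_U4_N16_le_of_claim hE2))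

/-- Its window is `[q₊/16, −q₋/16]`. [cite: QinEtAl2020, §II eqs. (2)–(4)] -/
theorem pairListWindowCert_4x4_U4_N16_tp0_of_mbbootE2_lo_hi {n : ℕ} (lam : Fin n → ℝ) (r : Fin n → Site 2)
    {qp qm : ℝ}
    (Cp : TorusSectorObsCertTT' 4 1 0 4 16 0 ((-7488692256025 : ℝ) / 2 ^ 39) (pairListObjective 4 lam r) qp)
    (Cm : TorusSectorObsCertTT' 4 1 0 4 16 0 ((-7488692256025 : ℝ) / 2 ^ 39)
      (pairListObjective 4 (fun i => -lam i) r) qm)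
    (hE2 : Bounds.torusUpper_mbbootE2_4x4_U4_N16) :
    (pairListWindowCert_4x4_U4_N16_tp0_of_mbbootE2 lam r Cp Cm hE2).lo = qp / 16 ∧
      (pairListWindowCert_4x4_U4_N16_tp0_of_mbbootE2 lam r Cp Cm hE2).hi = -qm / 16 := by
  constructor <;>
    norm_num [pairListWindowCert_4x4_U4_N16_tp0_of_mbbootE2, PairListWindowCert.ofSectorListCerts]

/-- **PD1 / PD1m reading (`objective_h0_coeff` a ≥ 0; PD1: a = 1, κ = 0, class mean `±1/4`).** From the `+λ`
file `a•H + P_λ ≥ q₊` and the `−λ` file `a•H + P_{−λ} ≥ q₋` on the sector, an upper claim `groundEnergyAt ≤ u`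
matching the files' `u`, and ANY typed upper node `u'`: the LIST WINDOW `[(q₊ − a u')/16, (a u' − q₋)/16]` on
`Σᵢ λᵢ P̄_d(4, rᵢ; ψ)` (a κ = 0 file reads at every `u`: move it to the node first with
`TorusSectorObsCertTT'.transportU`). NOT RUN. HONEST FRAMING: ladder R1–R4 with certified numbers; no claim on
H/H₀. [cite: Han2020Bootstrap, §2–§3] [cite: QinEtAl2020, §II eqs. (2)–(4)] -/
def pairListWindowCert_4x4_U4_N16_tp0_h0coeff_nonneg_of_certs {n : ℕ} {a : ℝ} (ha : 0 ≤ a)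
    (lam : Fin n → ℝ) (r : Fin n → Site 2) {u u' qp qm : ℝ}
    (Cp : TorusSectorObsCertTT' 4 1 0 4 16 0 u
      (((a : ℝ) : ℂ) • hubbardTorusTT' 4 1 0 4 + pairListObjective 4 lam r) qp)
    (Cm : TorusSectorObsCertTT' 4 1 0 4 16 0 u
      (((a : ℝ) : ℂ) • hubbardTorusTT' 4 1 0 4 + pairListObjective 4 (fun i => -lam i) r) qm)
    (hup : groundEnergyAt (fermionTorusGraph 2 4) 1 4 16 ≤ u)
    (hup' : groundEnergyAt (fermionTorusGraph 2 4) 1 4 16 ≤ u') :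
    PairListWindowCert (fun L => hubbardTorusTT' L 1 0 4) (fun _ => 16) 4 lam r where
  lo := (qp - a * u') / 16
  hi := (a * u' - qm) / 16
  sound ψ h₁ hgs := by
    refine ⟨pairListFloor_4x4_U4_N16_tp0_h0coeff_nonneg_of_certs ha lam r Cp hup hup' ψ h₁ hgs, ?_⟩
    have hm :=
      pairListFloor_4x4_U4_N16_tp0_h0coeff_nonneg_of_certs ha (fun i => -lam i) r Cm hup hup' ψ h₁ hgs
    simp only [neg_mul, Finset.sum_neg_distrib] at hm
    linarith

/-- Its window is `[(q₊ − a u')/16, (a u' − q₋)/16]`. [folklore] -/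
theorem pairListWindowCert_4x4_U4_N16_tp0_h0coeff_nonneg_of_certs_lo_hi {n : ℕ} {a : ℝ} (ha : 0 ≤ a)
    (lam : Fin n → ℝ) (r : Fin n → Site 2) {u u' qp qm : ℝ}
    (Cp : TorusSectorObsCertTT' 4 1 0 4 16 0 u
      (((a : ℝ) : ℂ) • hubbardTorusTT' 4 1 0 4 + pairListObjective 4 lam r) qp)
    (Cm : TorusSectorObsCertTT' 4 1 0 4 16 0 u
      (((a : ℝ) : ℂ) • hubbardTorusTT' 4 1 0 4 + pairListObjective 4 (fun i => -lam i) r) qm)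
    (hup : groundEnergyAt (fermionTorusGraph 2 4) 1 4 16 ≤ u)
    (hup' : groundEnergyAt (fermionTorusGraph 2 4) 1 4 16 ≤ u') :
    (pairListWindowCert_4x4_U4_N16_tp0_h0coeff_nonneg_of_certs ha lam r Cp Cm hup hup').lo
        = (qp - a * u') / 16 ∧
      (pairListWindowCert_4x4_U4_N16_tp0_h0coeff_nonneg_of_certs ha lam r Cp Cm hup hup').hi
        = (a * u' - qm) / 16 :=
  ⟨rfl, rfl⟩

/-- **PD1 / PD1m reading keyed to the E2 node** (`u = u' = −7488692256025/2³⁹`; files at another `u` are moved there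
by `transportU` when κ = 0, or read through `…_of_certs` with their own upper claim): window
`[(q₊ − a u_E2)/16, (a u_E2 − q₋)/16]`. NOT RUN. HONEST FRAMING: ladder R1–R4 with certified numbers; no claim on
H/H₀. [cite: Han2020Bootstrap, §2–§3] [cite: Tasaki2020, §2.1] -/
def pairListWindowCert_4x4_U4_N16_tp0_h0coeff_nonneg_of_mbbootE2 {n : ℕ} {a : ℝ} (ha : 0 ≤ a)
    (lam : Fin n → ℝ) (r : Fin n → Site 2) {qp qm : ℝ}
    (Cp : TorusSectorObsCertTT' 4 1 0 4 16 0 ((-7488692256025 : ℝ) / 2 ^ 39)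
      (((a : ℝ) : ℂ) • hubbardTorusTT' 4 1 0 4 + pairListObjective 4 lam r) qp)
    (Cm : TorusSectorObsCertTT' 4 1 0 4 16 0 ((-7488692256025 : ℝ) / 2 ^ 39)
      (((a : ℝ) : ℂ) • hubbardTorusTT' 4 1 0 4 + pairListObjective 4 (fun i => -lam i) r) qm)
    (hE2 : Bounds.torusUpper_mbbootE2_4x4_U4_N16) :
    PairListWindowCert (fun L => hubbardTorusTT' L 1 0 4) (fun _ => 16) 4 lam r :=
  pairListWindowCert_4x4_U4_N16_tp0_h0coeff_nonneg_of_certs ha lam r Cp Cm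
    (Bounds.groundEnergyAt_4x4_U4_N16_le_of_claim hE2) (Bounds.groundEnergyAt_4x4_U4_N16_le_of_claim hE2)

/-- Its window is `[(q₊ − a u_E2)/16, (a u_E2 − q₋)/16]` with `u_E2 = −7488692256025/2³⁹`. [folklore] -/
theorem pairListWindowCert_4x4_U4_N16_tp0_h0coeff_nonneg_of_mbbootE2_lo_hi {n : ℕ} {a : ℝ} (ha : 0 ≤ a)
    (lam : Fin n → ℝ) (r : Fin n → Site 2) {qp qm : ℝ}
    (Cp : TorusSectorObsCertTT' 4 1 0 4 16 0 ((-7488692256025 : ℝ) / 2 ^ 39)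
      (((a : ℝ) : ℂ) • hubbardTorusTT' 4 1 0 4 + pairListObjective 4 lam r) qp)
    (Cm : TorusSectorObsCertTT' 4 1 0 4 16 0 ((-7488692256025 : ℝ) / 2 ^ 39)
      (((a : ℝ) : ℂ) • hubbardTorusTT' 4 1 0 4 + pairListObjective 4 (fun i => -lam i) r) qm)
    (hE2 : Bounds.torusUpper_mbbootE2_4x4_U4_N16) :
    (pairListWindowCert_4x4_U4_N16_tp0_h0coeff_nonneg_of_mbbootE2 ha lam r Cp Cm hE2).lo
        = (qp - a * ((-7488692256025 : ℝ) / 2 ^ 39)) / 16 ∧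
      (pairListWindowCert_4x4_U4_N16_tp0_h0coeff_nonneg_of_mbbootE2 ha lam r Cp Cm hE2).hi
        = (a * ((-7488692256025 : ℝ) / 2 ^ 39) - qm) / 16 :=
  ⟨rfl, rfl⟩

/-! ### Typed obligation (house style: `@[conjecture] def` + `_holds`; an implication from certificates nobody holds) -/

/-- **Typed obligation — LIST WINDOWS at `L = 4` from the first job's ± pairs (E2-keyed).** On the `4 × 4` torus at
`t = 1`, `t' = 0`, `U = 4`, sector `(16, S^z = 0)`, given the E2 upper claim: (1) a `+λ` and a `−λ` list certificate
with values `q₊`, `q₋` written against `u = −7488692256025/2³⁹` give, for every unit ground state `ψ` of the sector,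
`q₊/16 ≤ Σᵢ λᵢ P̄_d(4, rᵢ; ψ) ≤ −q₋/16`; (2) for `0 ≤ a`, a `+λ` and a `−λ` certificate for `a•H + P_{±λ}` with values
`q₊`, `q₋` at that `u` give `(q₊ − a u)/16 ≤ Σᵢ λᵢ P̄_d(4, rᵢ; ψ) ≤ (a u − q₋)/16`. PROVED
(`pairDDListWindowsFourE2_holds`); NO such certificate exists; NOT an R3 instance. HONEST FRAMING: ladder R1–R4
with certified numbers; no claim on H/H₀. [cite: QinEtAl2020, §II eqs. (2)–(4)] [cite: Han2020Bootstrap, §2–§3] -/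
@[conjecture] def PairDDListWindowsFourE2 : Prop :=
  ∀ (n : ℕ) (lam : Fin n → ℝ) (r : Fin n → Site 2) (a qp qm : ℝ),
    Bounds.torusUpper_mbbootE2_4x4_U4_N16 →
      (Nonempty (TorusSectorObsCertTT' 4 1 0 4 16 0 ((-7488692256025 : ℝ) / 2 ^ 39)
          (pairListObjective 4 lam r) qp) →
        Nonempty (TorusSectorObsCertTT' 4 1 0 4 16 0 ((-7488692256025 : ℝ) / 2 ^ 39)
          (pairListObjective 4 (fun i => -lam i) r) qm) →
        ∀ ψ : Fock (Orb (FermionTorus 2 4)), star ψ ⬝ᵥ ψ = 1 →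
          IsGroundStateInSector (hubbardTorusTT' 4 1 0 4) 16 0 ψ →
            qp / 16 ≤ ∑ i, lam i * avgPairCorr 4 (r i) ψ ∧ ∑ i, lam i * avgPairCorr 4 (r i) ψ ≤ -qm / 16) ∧
      (0 ≤ a →
        Nonempty (TorusSectorObsCertTT' 4 1 0 4 16 0 ((-7488692256025 : ℝ) / 2 ^ 39)
          (((a : ℝ) : ℂ) • hubbardTorusTT' 4 1 0 4 + pairListObjective 4 lam r) qp) →
        Nonempty (TorusSectorObsCertTT' 4 1 0 4 16 0 ((-7488692256025 : ℝ) / 2 ^ 39)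
          (((a : ℝ) : ℂ) • hubbardTorusTT' 4 1 0 4 + pairListObjective 4 (fun i => -lam i) r) qm) →
        ∀ ψ : Fock (Orb (FermionTorus 2 4)), star ψ ⬝ᵥ ψ = 1 →
          IsGroundStateInSector (hubbardTorusTT' 4 1 0 4) 16 0 ψ →
            (qp - a * ((-7488692256025 : ℝ) / 2 ^ 39)) / 16 ≤ ∑ i, lam i * avgPairCorr 4 (r i) ψ ∧
              ∑ i, lam i * avgPairCorr 4 (r i) ψ ≤ (a * ((-7488692256025 : ℝ) / 2 ^ 39) - qm) / 16)

/-- `PairDDListWindowsFourE2` holds: the windows of §3b, read through `PairListWindowCert.sound`.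
[cite: QinEtAl2020, §II eqs. (2)–(4)] -/
theorem pairDDListWindowsFourE2_holds : PairDDListWindowsFourE2 := by
  intro n lam r a qp qm hE2
  refine ⟨fun ⟨Cp⟩ ⟨Cm⟩ ψ hψ1 hgs => ?_, fun ha ⟨Cp⟩ ⟨Cm⟩ ψ hψ1 hgs => ?_⟩
  · have h := (pairListWindowCert_4x4_U4_N16_tp0_of_mbbootE2 lam r Cp Cm hE2).sound ψ hψ1 hgs
    have hlh := pairListWindowCert_4x4_U4_N16_tp0_of_mbbootE2_lo_hi lam r Cp Cm hE2
    rw [hlh.1, hlh.2] at h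
    exact h
  · have h := (pairListWindowCert_4x4_U4_N16_tp0_h0coeff_nonneg_of_mbbootE2 ha lam r Cp Cm hE2).sound ψ hψ1 hgs
    exact h

end FourByFourWindows

end Summit.HubbardSuperconductivity.HubbardLadder
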